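import Summits.PneNP.PneNP.Theorems.SzkEntropyPeaWorstToAvgStubOrbitKitGLSampler
import Literature.Computability.Complexity.PolynomialEntropyApproximationDegOne
import Literature.Computability.Complexity.PEASigmaTwoFP
import Literature.Computability.Complexity.CodeFPFinite
import HarnessLib

/-!
# Orbit kit for `orbit-pair-rsr`, VII: the core map is polynomial time on codes

Helper file of the stub `stub_orbitKit` (crux `SzkEntropy.PeaWorstToAvg`, line `orbit-pair-rsr`).
In the typed `FP` algebra `CodeFP` (environment-passing style: every lemma takes the certificates of
its arguments as functions of an arbitrary environment `θ`) we certify the core map `OKit.core`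
(`…StubOrbitKitGLSampler.lean`):

* the coin-reading layer — `readVecE`, `readMatE`, `idRowsE`, `invE` (rank test,
  `GaussRank.codeFP_lrank`), `blocksE`, `selE` (first invertible candidate, identity fallback), and the
  components `gAE`, `gbE`, `gBE`, `gcE` of the group element; matrices and vectors over `F₂` are raw
  lists of `GaussRank.zmodE 2` residues (`matE`, `vecE`);
* the symbolic layer (`…StubOrbitKitSubst.lean`, `…ANF.lean`) — `affFormE`, `substMonoE`, `substPE`,
  `mixPE`, `transformE`, `allMonosE`, `sameSetE`, `canonPE`, `canonME`; monomials are raw lists of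
  binary numerals, polynomials and maps raw lists thereof;
* **`coreFP`**: `CodeFP (pairE untypedCode strE) untypedCode (core t)` — ONE polynomial-time string
  function computing, on the code of an untyped `PEA` instance paired with a coin string, the code of
  the re-randomised and normalised instance.

References: S. Arora, B. Barak, *Computational Complexity*, CUP 2009, §1.3 (closure of polynomial
time under composition and polynomially bounded loops).
-/

namespace Summit.PneNP.PneNP.Cruxes.PeaWorstToAvg.OrbitPairRsr

set_option linter.dupNamespace false -- Summit.PneNP.PneNP: summit = sub-problem (D-0017)

open Literature.Computability.Complexity CodeFP PEAHash RandPoly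

namespace OKit


/-! ### Codes -/

/-- Residues of `F₂`: the binary numeral of the value (`0 ↦ ε`). [folklore] -/
abbrev z2E : ZMod 2 → List Bool := GaussRank.zmodE 2

/-- Vectors over `F₂`: raw lists of residues. [folklore] -/
abbrev vecE : List (ZMod 2) → List Bool := rawE z2E

/-- Matrices over `F₂`: raw lists of rows. [folklore] -/
abbrev matE : List (List (ZMod 2)) → List Bool := rawE vecE

variable {θ α β : Type} {eθ : θ → List Bool} {eα : α → List Bool} {eβ : β → List Bool}

/-! ### Environment-passing list combinators -/

/-- `map` over a computed list with a body reading the environment. [cite: AroraBarak2009, §1.3] -/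
theorem mapE {fl : θ → List α} {g : θ × α → β} (hl : CodeFP eθ (rawE eα) fl) (hg : CodeFP (pairE eθ eα) eβ g) :
    CodeFP eθ (rawE eβ) (fun x => (fl x).map fun a => g (x, a)) :=
  (map hg).comp ((CodeFP.id eθ).pair hl)

/-- `filter` over a computed list with a test reading the environment. [cite: AroraBarak2009, §1.3] -/
theorem filterE {fl : θ → List α} {p : θ × α → Bool} (hl : CodeFP eθ (rawE eα) fl) (hp : CodeFP (pairE eθ eα) bitE p) :
    CodeFP eθ (rawE eα) (fun x => (fl x).filter fun a => p (x, a)) :=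
  (filter hp).comp ((CodeFP.id eθ).pair hl)

/-- `flatMap` over a computed list with a body reading the environment. [cite: AroraBarak2009, §1.3] -/
theorem flatMapE {fl : θ → List α} {g : θ × α → List β} (hl : CodeFP eθ (rawE eα) fl)
    (hg : CodeFP (pairE eθ eα) (rawE eβ) g) : CodeFP eθ (rawE eβ) (fun x => (fl x).flatMap fun a => g (x, a)) :=
  ((flatten eβ).comp (mapE hl hg)).congr fun x => by rw [List.flatMap_def]

/-! ### Reading vectors and matrices off the coins -/

/-- A coin as a residue. [folklore] -/
theorem bzFP : CodeFP bitE z2E bz :=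
  ((CodeFP.id bitE).ite (const bitE (1 : ZMod 2)) (const bitE (0 : ZMod 2))).congr fun b => by cases b <;> rfl

/-- `readVec` on codes (`s` unary, `u` a string). [cite: AroraBarak2009, §1.3] -/
theorem readVecE {fs : θ → ℕ} {fu : θ → List Bool} (hs : CodeFP eθ unE fs) (hu : CodeFP eθ strE fu) :
    CodeFP eθ vecE (fun x => readVec (fs x) (fu x)) :=
  (mapE (LLLFactoring.urangeUn.comp hs) (bzFP.comp (strGetD.comp ((snd _ _).pair (hu.comp (fst _ _)))))).congr
    fun _ => rfl

/-- `readMat` on codes. [cite: AroraBarak2009, §1.3] -/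
theorem readMatE {fs : θ → ℕ} {fu : θ → List Bool} (hs : CodeFP eθ unE fs) (hu : CodeFP eθ strE fu) :
    CodeFP eθ matE (fun x => readMat (fs x) (fu x)) :=
  (mapE (LLLFactoring.urangeUn.comp hs) (readVecE (hs.comp (fst _ _))
    (strDrop.comp ((unMulE (snd _ _) (hs.comp (fst _ _))).pair (hu.comp (fst _ _)))))).congr fun _ => rfl

/-- The identity rows on codes. [cite: AroraBarak2009, §1.3] -/
theorem idRowsE {fs : θ → ℕ} (hs : CodeFP eθ unE fs) : CodeFP eθ matE (fun x => idRows (fs x)) := by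
  have hij : CodeFP (pairE (pairE eθ unE) unE) bitE (fun y => decide (y.1.2 = y.2)) :=
    (CodeFP.eq unE_injective).comp ((fst _ _).snd'.pair (snd _ _))
  have hent : CodeFP (pairE (pairE eθ unE) unE) z2E (fun y => if decide (y.1.2 = y.2) then (1 : ZMod 2) else 0) :=
    hij.ite (const _ (1 : ZMod 2)) (const _ (0 : ZMod 2))
  have hrow : CodeFP (pairE eθ unE) vecE
      (fun y => (List.range (fs y.1)).map fun j => if decide (y.2 = j) then (1 : ZMod 2) else 0) :=
    mapE (LLLFactoring.urangeUn.comp (hs.comp (fst _ _))) hent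
  refine (mapE (LLLFactoring.urangeUn.comp hs) hrow).congr fun x => ?_
  simp only [idRows, decide_eq_true_eq]

/-- The rank test on codes. [cite: AroraBarak2009, §1.3] -/
theorem invE {fs : θ → ℕ} {fR : θ → List (List (ZMod 2))} (hs : CodeFP eθ unE fs) (hR : CodeFP eθ matE fR) :
    CodeFP eθ bitE (fun x => inv (fs x) (fR x)) :=
  (natEq.comp ((GaussRank.codeFP_lrank.comp (hs.pair hR)).pair (natOfUn.comp hs))).congr fun _ => rfl

/-- The candidate blocks on codes (`t` a constant). [cite: AroraBarak2009, §1.3] -/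
theorem blocksE {fs : θ → ℕ} {fu : θ → List Bool} (hs : CodeFP eθ unE fs) (t : ℕ) (hu : CodeFP eθ strE fu) :
    CodeFP eθ (rawE matE) (fun x => blocks (fs x) t (fu x)) := by
  have hs1 : CodeFP (pairE eθ unE) unE (fun y => fs y.1) := hs.comp (fst _ _)
  have hss : CodeFP (pairE eθ unE) unE (fun y => fs y.1 * fs y.1) := unMulE hs1 hs1
  have hoff : CodeFP (pairE eθ unE) unE (fun y => y.2 * (fs y.1 * fs y.1)) := unMulE (snd _ _) hss
  have hwin : CodeFP (pairE eθ unE) strE (fun y => ((fu y.1).drop (y.2 * (fs y.1 * fs y.1))).take (fs y.1 * fs y.1)) :=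
    strTake.comp (hss.pair (strDrop.comp (hoff.pair (hu.comp (fst _ _)))))
  exact (mapE (LLLFactoring.urangeUn.comp (const eθ t)) (readMatE hs1 hwin)).congr fun _ => rfl

/-- `Option.getD` through a list. [folklore] -/
theorem headD_toList_append {γ : Type} (o : Option (List γ)) (d : List γ) : (o.toList ++ [d]).headD [] = o.getD d := by
  cases o <;> rfl

/-- **The truncated-rejection sampler on codes.** [cite: AroraBarak2009, §1.3] -/
theorem selE {fs : θ → ℕ} {fu : θ → List Bool} (hs : CodeFP eθ unE fs) (t : ℕ) (hu : CodeFP eθ strE fu) :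
    CodeFP eθ matE (fun x => sel (fs x) t (fu x)) := by
  have hfind : CodeFP eθ (optE matE) (fun x => (blocks (fs x) t (fu x)).find? (inv (fs x))) :=
    ((rawFind? (invE (hs.comp (fst _ _)) (snd eθ matE))).comp ((CodeFP.id eθ).pair (blocksE hs t hu))).congr
      fun _ => rfl
  have hlist : CodeFP eθ (rawE matE) (fun x => ((blocks (fs x) t (fu x)).find? (inv (fs x))).toList ++ [idRows (fs x)]) :=
    (rawAppend matE).comp (((optToList matE).comp hfind).pair ((rawSingleton matE).comp (idRowsE hs)))
  exact ((rawHeadD matE (d := ([] : List (List (ZMod 2)))) rfl).comp hlist).congr fun x => by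
    rw [sel, ← headD_toList_append]

/-! ### The group element read off the coins -/

/-- `gA` on codes. [cite: AroraBarak2009, §1.3] -/
theorem gAE {fs : θ → ℕ} {fr : θ → List Bool} (hs : CodeFP eθ unE fs) (t : ℕ) (hr : CodeFP eθ strE fr) :
    CodeFP eθ matE (fun x => gA (fs x) t (fr x)) :=
  (selE hs t (strTake.comp ((unMulE (const eθ t) (unMulE hs hs)).pair hr))).congr fun _ => rfl

/-- `gb` on codes. [cite: AroraBarak2009, §1.3] -/
theorem gbE {fs : θ → ℕ} {fr : θ → List Bool} (hs : CodeFP eθ unE fs) (t : ℕ) (hr : CodeFP eθ strE fr) :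
    CodeFP eθ vecE (fun x => gb (fs x) t (fr x)) :=
  (readVecE hs (strTake.comp (hs.pair (strDrop.comp ((unMulE (const eθ t) (unMulE hs hs)).pair hr))))).congr
    fun _ => rfl

/-- The coins after the input part: `(r ⇂ t s²) ⇂ s`. [folklore] -/
theorem restE {fs : θ → ℕ} {fr : θ → List Bool} (hs : CodeFP eθ unE fs) (t : ℕ) (hr : CodeFP eθ strE fr) :
    CodeFP eθ strE (fun x => ((fr x).drop (t * (fs x * fs x))).drop (fs x)) :=
  strDrop.comp (hs.pair (strDrop.comp ((unMulE (const eθ t) (unMulE hs hs)).pair hr)))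

/-- `gB` on codes. [cite: AroraBarak2009, §1.3] -/
theorem gBE {fs fm : θ → ℕ} {fr : θ → List Bool} (hs : CodeFP eθ unE fs) (hm : CodeFP eθ unE fm) (t : ℕ)
    (hr : CodeFP eθ strE fr) : CodeFP eθ matE (fun x => gB (fs x) (fm x) t (fr x)) :=
  (selE hm t (strTake.comp ((unMulE (const eθ t) (unMulE hm hm)).pair (restE hs t hr)))).congr fun _ => rfl

/-- `gc` on codes. [cite: AroraBarak2009, §1.3] -/
theorem gcE {fs fm : θ → ℕ} {fr : θ → List Bool} (hs : CodeFP eθ unE fs) (hm : CodeFP eθ unE fm) (t : ℕ)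
    (hr : CodeFP eθ strE fr) : CodeFP eθ vecE (fun x => gc (fs x) (fm x) t (fr x)) :=
  (readVecE hm (strTake.comp (hm.pair (strDrop.comp ((unMulE (const eθ t) (unMulE hm hm)).pair
    (restE hs t hr)))))).congr fun _ => rfl


/-- Monomials: raw lists of binary numerals. [folklore] -/
abbrev monoE : List ℕ → List Bool := rawE natE

/-- Polynomials: raw lists of monomials. [folklore] -/
abbrev polyE : List (List ℕ) → List Bool := rawE monoE

/-- Maps: raw lists of polynomials. [folklore] -/
abbrev pmapE : List (List (List ℕ)) → List Bool := rawE polyE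

/-! ### Entries, affine forms, substitution -/

/-- Matrix entries `ent A i j` on codes (`i`, `j` binary). [cite: AroraBarak2009, §1.3] -/
theorem entE {fA : θ → List (List (ZMod 2))} {fi fj : θ → ℕ} (hA : CodeFP eθ matE fA) (hi : CodeFP eθ natE fi)
    (hj : CodeFP eθ natE fj) : CodeFP eθ z2E (fun x => ent (fA x) (fi x) (fj x)) :=
  ((rawGetD z2E GaussRank.zmodE_zero).comp (((rawGetD vecE (d := ([] : List (ZMod 2))) rfl).comp
    (hA.pair hi)).pair hj)).congr fun _ => rfl

/-- Vector entries `b.getD i 0` on codes. [cite: AroraBarak2009, §1.3] -/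
theorem getDE {fb : θ → List (ZMod 2)} {fi : θ → ℕ} (hb : CodeFP eθ vecE fb) (hi : CodeFP eθ natE fi) :
    CodeFP eθ z2E (fun x => (fb x).getD (fi x) 0) :=
  (rawGetD z2E GaussRank.zmodE_zero).comp (hb.pair hi)

/-- The constant part `if v = 0 then [] else [[]]` on codes. [cite: AroraBarak2009, §1.3] -/
theorem constPartE {fv : θ → ZMod 2} (hv : CodeFP eθ z2E fv) :
    CodeFP eθ polyE (fun x => if fv x = 0 then ([] : List (List ℕ)) else [[]]) :=
  ((GaussRank.zmodIsZero.comp hv).ite (const eθ ([] : List (List ℕ))) (const eθ [([] : List ℕ)])).congr fun x => by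
    by_cases h : fv x = 0 <;> simp [h]

/-- **The affine form on codes.** [cite: AroraBarak2009, §1.3] -/
theorem affFormE {fs : θ → ℕ} {fA : θ → List (List (ZMod 2))} {fb : θ → List (ZMod 2)} {fi : θ → ℕ}
    (hs : CodeFP eθ unE fs) (hA : CodeFP eθ matE fA) (hb : CodeFP eθ vecE fb) (hi : CodeFP eθ natE fi) :
    CodeFP eθ polyE (fun x => affForm (fs x) (fA x) (fb x) (fi x)) := by
  have hpred : CodeFP (pairE eθ natE) bitE (fun y => !decide (ent (fA y.1) (fi y.1) y.2 = 0)) :=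
    (GaussRank.zmodIsZero.comp (entE (hA.comp (fst _ _)) (hi.comp (fst _ _)) (snd _ _))).not
  have hlin : CodeFP eθ polyE (fun x => ((List.range (fs x)).filter fun l => !decide (ent (fA x) (fi x) l = 0)).map
      fun l => [l]) := mapE (filterE (urange.comp hs) hpred) ((rawSingleton natE).comp (snd _ _))
  exact ((rawAppend monoE).comp (hlin.pair (constPartE (getDE hb hi)))).congr fun _ => rfl

/-- The optional factor: `affForm` of the variable, or `1`. [folklore] -/
def affOpt (s : ℕ) (A : List (List (ZMod 2))) (b : List (ZMod 2)) (o : Option ℕ) : List (List ℕ) :=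
  match o with
  | some i => affForm s A b i
  | none => [[]]

/-- `affO` through `affOpt`. [folklore] -/
theorem affO_eq (s : ℕ) (A : List (List (ZMod 2))) (b : List (ZMod 2)) (μ : List ℕ) (j : ℕ) :
    affO s A b μ j = affOpt s A b μ[j]? := by
  unfold affO affOpt
  cases μ[j]? <;> rfl

/-- **A factor of a substituted monomial on codes** (`j` a constant). [cite: AroraBarak2009, §1.3] -/
theorem affOE {fs : θ → ℕ} {fA : θ → List (List (ZMod 2))} {fb : θ → List (ZMod 2)} {fμ : θ → List ℕ}
    (hs : CodeFP eθ unE fs) (hA : CodeFP eθ matE fA) (hb : CodeFP eθ vecE fb) (hμ : CodeFP eθ monoE fμ) (j : ℕ) :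
    CodeFP eθ polyE (fun x => affO (fs x) (fA x) (fb x) (fμ x) j) := by
  have hopt : CodeFP eθ (optE natE) (fun x => (fμ x)[j]?) := (getOpt natE).comp ((const eθ j).pair hμ)
  have hcase := optCases (eσ := eθ) (eα := natE) (eδ := polyE) (k := fun x o => affOpt (fs x) (fA x) (fb x) o)
    (gnone := fun _ => [[]]) (gsome := fun y => affForm (fs y.1) (fA y.1) (fb y.1) y.2) (const eθ [([] : List ℕ)])
    (affFormE (hs.comp (fst _ _)) (hA.comp (fst _ _)) (hb.comp (fst _ _)) (snd _ _)) (fun _ => rfl) (fun _ _ => rfl)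
  exact (hcase.comp ((CodeFP.id eθ).pair hopt)).congr fun x => by rw [affO_eq]; rfl

/-- `mulP` through `map` and `flatten`. [folklore] -/
theorem mulP_eq (p q : List (List ℕ)) : mulP p q = (p.map fun μ => q.map fun ν => μ ++ ν).flatten := by
  rw [mulP, List.flatMap_def]

/-- **Products of sparse polynomials on codes.** [cite: AroraBarak2009, §1.3] -/
theorem mulPE {fp fq : θ → List (List ℕ)} (hp : CodeFP eθ polyE fp) (hq : CodeFP eθ polyE fq) :
    CodeFP eθ polyE (fun x => mulP (fp x) (fq x)) := by
  have hinner : CodeFP (pairE (pairE eθ monoE) monoE) monoE (fun y => y.1.2 ++ y.2) :=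
    (rawAppend natE).comp ((fst _ _).snd'.pair (snd _ _))
  have hrow : CodeFP (pairE eθ monoE) polyE (fun y => (fq y.1).map fun ν => y.2 ++ ν) :=
    mapE (hq.comp (fst _ _)) hinner
  exact ((flatten monoE).comp (mapE hp hrow)).congr fun x => by rw [mulP_eq]

/-- **Substituted monomials on codes.** [cite: AroraBarak2009, §1.3] -/
theorem substMonoE {fs : θ → ℕ} {fA : θ → List (List (ZMod 2))} {fb : θ → List (ZMod 2)} {fμ : θ → List ℕ}
    (hs : CodeFP eθ unE fs) (hA : CodeFP eθ matE fA) (hb : CodeFP eθ vecE fb) (hμ : CodeFP eθ monoE fμ) :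
    CodeFP eθ polyE (fun x => substMono (fs x) (fA x) (fb x) (fμ x)) :=
  (mulPE (affOE hs hA hb hμ 0) (mulPE (affOE hs hA hb hμ 1) (affOE hs hA hb hμ 2))).congr fun _ => rfl

/-- **Substituted polynomials on codes.** [cite: AroraBarak2009, §1.3] -/
theorem substPE {fs : θ → ℕ} {fA : θ → List (List (ZMod 2))} {fb : θ → List (ZMod 2)} {fp : θ → List (List ℕ)}
    (hs : CodeFP eθ unE fs) (hA : CodeFP eθ matE fA) (hb : CodeFP eθ vecE fb) (hp : CodeFP eθ polyE fp) :
    CodeFP eθ polyE (fun x => substP (fs x) (fA x) (fb x) (fp x)) :=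
  (flatMapE hp (substMonoE (hs.comp (fst _ _)) (hA.comp (fst _ _)) (hb.comp (fst _ _)) (snd _ _))).congr fun _ => rfl

/-! ### Output mixing and the transform -/

/-- **Mixed outputs on codes.** [cite: AroraBarak2009, §1.3] -/
theorem mixPE {fB : θ → List (List (ZMod 2))} {fc : θ → List (ZMod 2)} {fQ : θ → List (List (List ℕ))} {fi : θ → ℕ}
    (hB : CodeFP eθ matE fB) (hc : CodeFP eθ vecE fc) (hQ : CodeFP eθ pmapE fQ) (hi : CodeFP eθ natE fi) :
    CodeFP eθ polyE (fun x => mixP (fB x) (fc x) (fQ x) (fi x)) := by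
  have hpred : CodeFP (pairE eθ natE) bitE (fun y => !decide (ent (fB y.1) (fi y.1) y.2 = 0)) :=
    (GaussRank.zmodIsZero.comp (entE (hB.comp (fst _ _)) (hi.comp (fst _ _)) (snd _ _))).not
  have hsel : CodeFP eθ (rawE natE) (fun x => (List.range (fQ x).length).filter fun i => !decide (ent (fB x) (fi x) i = 0)) :=
    filterE (urange.comp ((ulength polyE).comp hQ)) hpred
  have hbody : CodeFP (pairE eθ natE) polyE (fun y => (fQ y.1).getD y.2 []) :=
    (rawGetD polyE (d := ([] : List (List ℕ))) rfl).comp ((hQ.comp (fst _ _)).pair (snd _ _))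
  exact ((rawAppend monoE).comp ((flatMapE hsel hbody).pair (constPartE (getDE hc hi)))).congr fun _ => rfl

/-- **The transform on codes.** [cite: AroraBarak2009, §1.3] -/
theorem transformE {fs : θ → ℕ} {fP : θ → List (List (List ℕ))} {fA fB : θ → List (List (ZMod 2))}
    {fb fc : θ → List (ZMod 2)} (hs : CodeFP eθ unE fs) (hP : CodeFP eθ pmapE fP) (hA : CodeFP eθ matE fA)
    (hb : CodeFP eθ vecE fb) (hB : CodeFP eθ matE fB) (hc : CodeFP eθ vecE fc) :
    CodeFP eθ pmapE (fun x => transform (fs x) (fP x) (fA x) (fb x) (fB x) (fc x)) := by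
  have hQ : CodeFP eθ pmapE (fun x => (fP x).map (substP (fs x) (fA x) (fb x))) :=
    mapE hP (substPE (hs.comp (fst _ _)) (hA.comp (fst _ _)) (hb.comp (fst _ _)) (snd _ _))
  exact (mapE (urange.comp ((ulength polyE).comp hP)) (mixPE (hB.comp (fst _ _)) (hc.comp (fst _ _))
    (hQ.comp (fst _ _)) (snd _ _))).congr fun _ => rfl

/-! ### The canonical form -/

/-- A two-element monomial `[i, j]` on codes. [folklore] -/
theorem pairMonoE {fi fj : θ → ℕ} (hi : CodeFP eθ natE fi) (hj : CodeFP eθ natE fj) :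
    CodeFP eθ monoE (fun x => [fi x, fj x]) :=
  (rawCons natE).comp (hi.pair ((rawSingleton natE).comp hj))

/-- **The enumeration of multilinear monomials of degree `≤ 3` on codes.** [cite: AroraBarak2009, §1.3] -/
theorem allMonosE {fs : θ → ℕ} (hs : CodeFP eθ unE fs) : CodeFP eθ polyE (fun x => allMonos (fs x)) := by
  have hR : CodeFP eθ (rawE natE) (fun x => List.range (fs x)) := urange.comp hs
  have h0 : CodeFP eθ polyE (fun _ => [([] : List ℕ)]) := const eθ _
  have h1 : CodeFP eθ polyE (fun x => (List.range (fs x)).map fun i => [i]) := mapE hR ((rawSingleton natE).comp (snd _ _))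
  have hpairs : CodeFP eθ (rawE (pairE natE natE)) (fun x => (List.range (fs x)) ×ˢ (List.range (fs x))) :=
    (rawProduct natE natE).comp (hR.pair hR)
  have h2 : CodeFP eθ polyE (fun x => (((List.range (fs x)) ×ˢ (List.range (fs x))).filter
      fun p => decide (p.1 < p.2)).map fun p => [p.1, p.2]) :=
    mapE (filterE hpairs (natLt.comp (snd _ _))) (pairMonoE (snd _ _).fst' (snd _ _).snd')
  have htriples : CodeFP eθ (rawE (pairE natE (pairE natE natE)))
      (fun x => (List.range (fs x)) ×ˢ ((List.range (fs x)) ×ˢ (List.range (fs x)))) :=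
    (rawProduct natE (pairE natE natE)).comp (hR.pair hpairs)
  have hpred3 : CodeFP (pairE eθ (pairE natE (pairE natE natE))) bitE
      (fun y => decide (y.2.1 < y.2.2.1) && decide (y.2.2.1 < y.2.2.2)) :=
    (natLt.comp ((snd _ _).fst'.pair (snd _ _).snd'.fst')).and (natLt.comp ((snd _ _).snd'.fst'.pair (snd _ _).snd'.snd'))
  have h3 : CodeFP eθ polyE (fun x => (((List.range (fs x)) ×ˢ ((List.range (fs x)) ×ˢ (List.range (fs x)))).filter
      fun p => decide (p.1 < p.2.1) && decide (p.2.1 < p.2.2)).map fun p => [p.1, p.2.1, p.2.2]) :=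
    mapE (filterE htriples hpred3) ((rawCons natE).comp ((snd _ _).fst'.pair
      (pairMonoE (snd _ _).snd'.fst' (snd _ _).snd'.snd')))
  exact ((rawAppend monoE).comp (((rawAppend monoE).comp (((rawAppend monoE).comp (h0.pair h1)).pair h2)).pair h3)).congr
    fun _ => rfl

/-- **`sameSet` on codes.** [cite: AroraBarak2009, §1.3] -/
theorem sameSetE : CodeFP (pairE monoE monoE) bitE (fun y => sameSet y.1 y.2) := by
  have hmem : CodeFP (pairE monoE natE) bitE (fun y => decide (y.2 ∈ y.1)) :=
    (mem natE_injective).comp ((snd _ _).pair (fst _ _))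
  have h1 : CodeFP (pairE monoE monoE) bitE (fun y => y.1.all fun i => decide (i ∈ y.2)) :=
    (all (hmem.comp ((fst _ _).snd'.pair (snd _ _)))).comp ((CodeFP.id _).pair (fst _ _))
  have h2 : CodeFP (pairE monoE monoE) bitE (fun y => y.2.all fun i => decide (i ∈ y.1)) :=
    (all (hmem.comp ((fst _ _).fst'.pair (snd _ _)))).comp ((CodeFP.id _).pair (snd _ _))
  exact (h1.and h2).congr fun _ => rfl

/-- **The canonical form on codes.** [cite: AroraBarak2009, §1.3] -/
theorem canonPE {fs : θ → ℕ} {fq : θ → List (List ℕ)} (hs : CodeFP eθ unE fs) (hq : CodeFP eθ polyE fq) :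
    CodeFP eθ polyE (fun x => canonP (fs x) (fq x)) := by
  -- the multiplicity of the variable set of `μ` in `q`, through a filter
  have hcnt : CodeFP (pairE eθ monoE) natE (fun y => ((fq y.1).filter fun ν => sameSet ν y.2).length) :=
    (natLength monoE).comp (filterE (hq.comp (fst _ _)) (sameSetE.comp ((snd _ _).pair (fst _ _).snd')))
  have hpar : CodeFP (pairE eθ monoE) bitE
      (fun y => decide (((fq y.1).filter fun ν => sameSet ν y.2).length % 2 = 1)) :=
    natEq.comp ((natMod.comp (hcnt.pair (const _ 2))).pair (const _ 1))
  exact (filterE (allMonosE hs) hpar).congr fun x => by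
    simp only [canonP, List.countP_eq_length_filter]

/-- **The canonical form of a map on codes.** [cite: AroraBarak2009, §1.3] -/
theorem canonME {fs : θ → ℕ} {fQ : θ → List (List (List ℕ))} (hs : CodeFP eθ unE fs) (hQ : CodeFP eθ pmapE fQ) :
    CodeFP eθ pmapE (fun x => canonM (fs x) (fQ x)) :=
  (mapE hQ (canonPE (hs.comp (fst _ _)) (snd _ _))).congr fun _ => rfl

/-! ### The core map -/

/-- From raw nested lists to the headed-list code of a map. [folklore] -/
theorem listOfRaw3 : CodeFP pmapE (listE (listE (listE natE))) id := by
  have h1 : CodeFP polyE (rawE (listE natE)) (fun p => p.map id) := map₀ (listOfRaw natE)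
  have h2 : CodeFP polyE (listE (listE natE)) id := ((listOfRaw (listE natE)).comp h1).congr fun p => by simp
  have h3 : CodeFP pmapE (rawE (listE (listE natE))) (fun P => P.map id) := map₀ h2
  exact ((listOfRaw (listE (listE natE))).comp h3).congr fun P => by simp

/-- **The core map of the orbit kit is computed on codes by a polynomial-time string function.**
[cite: AroraBarak2009, §1.3] -/
theorem coreFP (t : ℕ) : CodeFP (pairE PEAInst.untypedCode strE) PEAInst.untypedCode (fun x => core t x.1 x.2) := by
  -- the environment `((s, (P, k)), r)`
  have hsh : CodeFP (pairE PEAInst.untypedCode strE) shE (fun x => x.1) := fst _ _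
  have hs : CodeFP (pairE PEAInst.untypedCode strE) natE (fun x => x.1.1) := hsh.fst'
  have hk : CodeFP (pairE PEAInst.untypedCode strE) natE (fun x => x.1.2.2) := hsh.snd'.snd'
  have hP : CodeFP (pairE PEAInst.untypedCode strE) pmapE (fun x => x.1.2.1) := mapRawFP.comp hsh
  have hr : CodeFP (pairE PEAInst.untypedCode strE) strE (fun x => x.2) := snd _ _
  have hm : CodeFP (pairE PEAInst.untypedCode strE) unE (fun x => x.1.2.1.length) := (ulength polyE).comp hP
  have hs' : CodeFP (pairE PEAInst.untypedCode strE) unE (fun x => min x.1.1 x.1.2.1.length) :=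
    unOfNatMin.comp (hm.pair hs)
  have hout : CodeFP (pairE PEAInst.untypedCode strE) pmapE
      (fun x => outMapG (min x.1.1 x.1.2.1.length) x.1.2.1.length t x.1.2.1 x.2) :=
    (canonME hs' (transformE hs' hP (gAE hs' t hr) (gbE hs' t hr) (gBE hs' hm t hr) (gcE hs' hm t hr))).congr
      fun _ => rfl
  exact (hs.pair ((listOfRaw3.comp hout).pair hk)).congr fun _ => rfl

end OKit

/-- **The core map is polynomial time on codes (anchor of the helper file).** [cite: AroraBarak2009, §1.3] -/
theorem orbitKit_coreFP (t : ℕ) :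
    CodeFP (CodeFP.pairE PEAInst.untypedCode CodeFP.strE) PEAInst.untypedCode (fun x => OKit.core t x.1 x.2) :=
  OKit.coreFP t

end Summit.PneNP.PneNP.Cruxes.PeaWorstToAvg.OrbitPairRsr
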